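import Literature.NumberTheory.GaloisRepresentations.ResidualRepUnique
import Literature.NumberTheory.GaloisRepresentations.CarayolSerreLemmasProofs
import Literature.RepresentationTheory.Semisimple.BurnsideMatrixSpan
import HarnessLib

/-!
# Stub B `stub_symmetricSimilitudeForm` (line `birth`, crux `AdjointSeedFromDuality`, stmt-Langlands-16780)

Pure algebra over an algebraically closed field `k` with `2 ≠ 0`: if `ρ̄ : G → GL₃(k)` is
absolutely irreducible and `tr ρ̄(g) = ν̄(g) tr ρ̄(g⁻¹)` for a character `ν̄`, then there is a
SYMMETRIC invertible `A` with `ρ̄(g)ᵀ A ρ̄(g) = ν̄(g) A` for all `g` (`ρ̄` is an orthogonal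
similitude representation).

Proof.  The twisted dual `ρ' : g ↦ ν̄(g) (ρ̄(g)⁻¹)ᵀ` is a representation with the same traces as
`ρ̄`.  By Burnside (`Literature.RepresentationTheory.Semisimple.span_eq_top_of_isIrreducible`) the
`ρ̄(g)` span `M₃(k)`, hence so do the `ρ'(g)`
(`CarayolSerre.span_eq_top_of_span_eq_top_of_trace_eq`), and equal traces give an algebra
endomorphism of `M₃(k)` carrying `ρ̄(g)` to `ρ'(g)` (`CarayolSerre.exists_algHom_map_eq`), which is
inner (`CarayolSerre.exists_units_forall_map_eq_conj`): `A ρ̄(g) A⁻¹ = ν̄(g) (ρ̄(g)⁻¹)ᵀ`, i.e.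
`ρ̄(g)ᵀ A ρ̄(g) = ν̄(g) A`.  Transposing, `Aᵀ` satisfies the same identity, so `A⁻¹ Aᵀ` commutes
with every `ρ̄(g)`, hence with all of `M₃(k)`, hence is a scalar `c`: `Aᵀ = c A`.  Transposing
again `c² = 1`; if `c = -1` then `det A = det Aᵀ = det (-A) = -det A`, so `2 det A = 0`,
contradicting `2 ≠ 0` and `det A ≠ 0`.  Hence `c = 1` and `A` is symmetric.

No `sorry`, no new definition, no named fact.
-/

set_option linter.dupNamespace false -- `Summit.Langlands.Langlands` is the mandated namespace
set_option autoImplicit false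

namespace Summit.Langlands.Langlands.Cruxes.AdjointSeedFromDuality.Birth

open scoped MatrixGroups
open Literature.NumberTheory.GaloisRepresentations

/-- The **twisted dual** `g ↦ ν̄(g) • (ρ̄(g)⁻¹)ᵀ` of `ρ̄ : G → GL₃(k)` by a character `ν̄` is a
group homomorphism `G → GL₃(k)` (inverse-transpose is multiplicative and scalars are central).
[folklore] -/
private theorem exists_twistedDual {k : Type} [Field k] {G : Type} [Group G]
    (ρbar : G →* GL (Fin 3) k) (νbar : G →* kˣ) :
    ∃ ρ' : G →* GL (Fin 3) k, ∀ g,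
      (ρ' g).val = (νbar g).val • ((ρbar g)⁻¹).val.transpose := by
  refine ⟨MonoidHom.mk' (fun g => ⟨(νbar g).val • ((ρbar g)⁻¹).val.transpose,
      ((νbar g)⁻¹).val • (ρbar g).val.transpose, ?_, ?_⟩) ?_, fun g => rfl⟩
  · rw [smul_mul_smul_comm, ← Matrix.transpose_mul, Units.mul_inv, Units.mul_inv,
      Matrix.transpose_one, one_smul]
  · rw [smul_mul_smul_comm, ← Matrix.transpose_mul, Units.inv_mul, Units.inv_mul,
      Matrix.transpose_one, one_smul]
  · intro a b
    ext : 1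
    simp only [map_mul, mul_inv_rev, Units.val_mul, Matrix.transpose_mul, smul_mul_smul_comm]

/-- **STUB B — trace duality ⇒ symmetric similitude form** (pure algebra).  Over an algebraically
closed field `k` with `2 ≠ 0`: if `ρ̄ : G → GL₃(k)` is absolutely irreducible and
`tr ρ̄(g) = ν̄(g) tr ρ̄(g⁻¹)` for a character `ν̄`, then `ρ̄(g)ᵀ A ρ̄(g) = ν̄(g) A` for a symmetric
invertible `A`.  Proof: the twisted dual `g ↦ ν̄(g) ρ̄(g)^{-ᵀ}` has the same traces as `ρ̄`;
Burnside (`span_eq_top_of_isIrreducible`) and the Carayol–Serre lemmas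
(`CarayolSerre.span_eq_top_of_span_eq_top_of_trace_eq`, `CarayolSerre.exists_algHom_map_eq`,
`CarayolSerre.exists_units_forall_map_eq_conj`) conjugate one into the other by some `A`:
`ρ̄(g)ᵀ A ρ̄(g) = ν̄(g) A`; `Aᵀ` satisfies the same, so `A⁻¹Aᵀ` centralises `ρ̄(G)`, hence
`M₃(k)`, hence `Aᵀ = c A`, `c = ±1`; an antisymmetric `3 × 3` matrix has determinant `0`
(`det A = det(−A) = −det A`, `2 ≠ 0`).
[cite: DarmonDiamondTaylor1995, §2.1, Prop. 2.6] [folklore] -/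
theorem stub_symmetricSimilitudeForm {k : Type} [Field k] [IsAlgClosed k]
    (h2 : (2 : k) ≠ 0) {G : Type} [Group G]
    (ρbar : G →* GL (Fin 3) k) (νbar : G →* kˣ) (hirr : IsAbsIrreducible ρbar)
    (hdual : ∀ g, (ρbar g).val.trace = (νbar g).val * (ρbar g⁻¹).val.trace) :
    ∃ A : Matrix (Fin 3) (Fin 3) k, A.IsSymm ∧ A.det ≠ 0 ∧
      ∀ g, (ρbar g).val.transpose * A * (ρbar g).val = (νbar g).val • A := by
  -- the twisted dual `ρ'` and its traces
  obtain ⟨ρ', hρ'⟩ := exists_twistedDual ρbar νbar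
  have htr : ∀ g, (ρ' g).val.trace = (ρbar g).val.trace := fun g => by
    rw [hρ', Matrix.trace_smul, Matrix.trace_transpose, hdual g, map_inv, smul_eq_mul]
  -- Burnside for `ρ̄`, then for `ρ'`; the algebra endomorphism and its inner form
  have hspan : Submodule.span k (Set.range fun g => (ρbar g).val) = ⊤ :=
    Literature.RepresentationTheory.Semisimple.span_eq_top_of_isIrreducible
      (hirr := hirr.isIrreducible_glRepresentation) ρbar
  have hspan' : Submodule.span k (Set.range fun g => (ρ' g).val) = ⊤ :=
    CarayolSerre.span_eq_top_of_span_eq_top_of_trace_eq ρbar ρ' htr hspan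
  obtain ⟨f, hf⟩ := CarayolSerre.exists_algHom_map_eq ρbar ρ' htr hspan hspan'
  obtain ⟨P, hP⟩ := CarayolSerre.exists_units_forall_map_eq_conj f
  -- the form `A := P` and its inverse `Ai`
  obtain ⟨A, Ai, hAAi, hAiA, hdet, hE1⟩ : ∃ A Ai : Matrix (Fin 3) (Fin 3) k,
      A * Ai = 1 ∧ Ai * A = 1 ∧ A.det ≠ 0 ∧
      ∀ g, A * (ρbar g).val * Ai = (νbar g).val • ((ρbar g)⁻¹).val.transpose :=
    ⟨P, (P⁻¹ : GL (Fin 3) k), P.mul_inv, P.inv_mul, P.det_ne_zero,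
      fun g => by rw [← hP, hf, hρ']⟩
  have hMMi : ∀ g, (ρbar g).val * ((ρbar g)⁻¹).val = 1 := fun g => (ρbar g).mul_inv
  have hMiM : ∀ g, ((ρbar g)⁻¹).val * (ρbar g).val = 1 := fun g => (ρbar g).inv_mul
  -- `ρ̄(g)ᵀ A ρ̄(g) = ν̄(g) A`
  have key : ∀ g, (ρbar g).val.transpose * A * (ρbar g).val = (νbar g).val • A := fun g => by
    calc (ρbar g).val.transpose * A * (ρbar g).val
        = (ρbar g).val.transpose * (A * (ρbar g).val * Ai) * A := by
          simp only [Matrix.mul_assoc, hAiA, Matrix.mul_one]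
      _ = (νbar g).val • A := by
          rw [hE1, Matrix.mul_smul, Matrix.smul_mul, ← Matrix.transpose_mul, hMiM,
            Matrix.transpose_one, Matrix.one_mul]
  -- the same for `Aᵀ`
  have keyT : ∀ g, (ρbar g).val.transpose * A.transpose * (ρbar g).val =
      (νbar g).val • A.transpose := fun g => by
    have h := congrArg Matrix.transpose (key g)
    rwa [Matrix.transpose_mul, Matrix.transpose_mul, Matrix.transpose_transpose,
      Matrix.transpose_smul, ← Matrix.mul_assoc] at h
  -- `ρ̄(g) A⁻¹ = ν̄(g) A⁻¹ (ρ̄(g)⁻¹)ᵀ` and `Aᵀ ρ̄(g) = ν̄(g) (ρ̄(g)⁻¹)ᵀ Aᵀ`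
  have E3 : ∀ g, (ρbar g).val * Ai = (νbar g).val • (Ai * ((ρbar g)⁻¹).val.transpose) :=
    fun g => by
      rw [← Matrix.mul_smul, ← hE1, ← Matrix.mul_assoc, ← Matrix.mul_assoc, hAiA, Matrix.one_mul]
  have E4 : ∀ g, A.transpose * (ρbar g).val =
      (νbar g).val • (((ρbar g)⁻¹).val.transpose * A.transpose) := fun g => by
    rw [← Matrix.mul_smul, ← keyT g, ← Matrix.mul_assoc, ← Matrix.mul_assoc,
      ← Matrix.transpose_mul, hMMi, Matrix.transpose_one, Matrix.one_mul]
  -- so `A⁻¹ Aᵀ` commutes with every `ρ̄(g)`, hence with all of `M₃(k)`, hence is a scalar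
  have hcomm : ∀ g, (ρbar g).val * (Ai * A.transpose) = Ai * A.transpose * (ρbar g).val :=
    fun g => by
      rw [← Matrix.mul_assoc, E3, Matrix.mul_assoc Ai, E4, Matrix.smul_mul, Matrix.mul_smul,
        Matrix.mul_assoc]
  have hall : ∀ X : Matrix (Fin 3) (Fin 3) k,
      X * (Ai * A.transpose) = Ai * A.transpose * X := by
    intro X
    have hX : X ∈ Submodule.span k (Set.range fun g => (ρbar g).val) := by
      rw [hspan]; exact Submodule.mem_top
    refine Submodule.span_induction ?_ ?_ ?_ ?_ hX
    · rintro _ ⟨g, rfl⟩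
      exact hcomm g
    · rw [Matrix.zero_mul, Matrix.mul_zero]
    · intro x y _ _ hx hy
      rw [Matrix.add_mul, Matrix.mul_add, hx, hy]
    · intro a x _ hx
      rw [Matrix.smul_mul, Matrix.mul_smul, hx]
  obtain ⟨c, hc⟩ : Ai * A.transpose ∈ Set.range (Matrix.scalar (Fin 3)) :=
    Matrix.mem_range_scalar_of_commute_single fun i j _ => hall _
  have hcA : A.transpose = c • A := by
    calc A.transpose = A * (Ai * A.transpose) := by
          rw [← Matrix.mul_assoc, hAAi, Matrix.one_mul]
      _ = c • A := by
          rw [← hc, Matrix.scalar_apply, ← Matrix.smul_one_eq_diagonal, Matrix.mul_smul,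
            Matrix.mul_one]
  -- `c² = 1`
  have hA0 : A ≠ 0 := fun h0 => hdet (by rw [h0, Matrix.det_zero])
  have hcc : c * c = 1 := by
    have h := congrArg Matrix.transpose hcA
    rw [Matrix.transpose_transpose, Matrix.transpose_smul, hcA, smul_smul] at h
    exact (smul_left_inj hA0).1 (h.symm.trans (one_smul k A).symm)
  refine ⟨A, ?_, hdet, key⟩
  rcases mul_self_eq_one_iff.1 hcc with rfl | rfl
  · exact hcA.trans (one_smul k A)
  · -- `Aᵀ = -A` forces `det A = 0` in odd rank when `2 ≠ 0`
    exfalso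
    have h := congrArg Matrix.det hcA
    rw [Matrix.det_transpose, Matrix.det_smul, Fintype.card_fin] at h
    have h' : (2 : k) * A.det = 0 := by linear_combination h
    exact hdet ((mul_eq_zero.1 h').resolve_left h2)

end Summit.Langlands.Langlands.Cruxes.AdjointSeedFromDuality.Birth
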